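import Literature.Topology.FourManifolds.NonSeparatingSpheresSurgeryDisc
import Literature.Topology.FourManifolds.UnorientedDiscTheorem
import HarnessLib

/-!
# Thickening the surgery disc; the Cerf–Palais disc theorem in `Sⁿ⁺¹` (Budney–Gabai Thm. 3.13, step IV)

Fact seat of `Literature.Topology.FourManifolds.BudneyGabai2019_thm_3_13` (`NonSeparatingSpheres.lean`;
R. Budney, D. Gabai, *Knotted 3-balls in `S⁴`*, arXiv:1912.09029 (v2), Thm. 3.13).  The source proves
its Thm. 3.12 (uniqueness of reducing balls, the last step of the proof of Thm. 3.13) alternatively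
as follows (remark after Thm. 3.12, p. 22): *"attach a `Sⁿ⁻¹ × D²` to obtain `Sⁿ⁺¹` where the
reducing ball is now an `n`-ball `Δ₁` with boundary a standard `(n-1)`-sphere. By the Cerf–Palais
theorem there is a diffeomorphism of this sphere taking `Δ₁` to a standard `n`-ball fixing `∂Δ₁`
pointwise."*  With `Δ₁ = φ(2𝔻ⁿ)` parametrised by the surgery disc `φ : ℝⁿ → Sⁿ⁺¹` of
`NonSeparatingSpheresSurgeryDisc.lean` and its unit normal field `ν`
(`NonSeparatingSpheresNormalField.lean`), this file carries out the Cerf–Palais step with the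
tree's disc theorem (`exists_diffeomorph_apply_disc_eq_or_reflect_cs`, `UnorientedDiscTheorem.lean`;
Palais 1960 / Cerf 1961 / Hirsch (1976), Ch. 8 §3, Thm. 3.1), in a RELATIVE form (identity near
`∂Δ₁`) obtained not from a relative disc theorem but from a shell trick: the two `(n+1)`-discs
compared by the disc theorem are thickenings of `φ` and of the standard disc `φ'` which *agree*
near the preimage of `∂Δ₁`.

* `Surgery.split` (`ℝⁿ⁺¹ = ℝⁿ × ℝ¹`), `Surgery.squeeze c ε` / `unsqueeze` / `squeezePD` — a global
  diffeomorphism `ℝⁿ⁺¹ ≃ B(0, c) × B(0, ε)`, linear `x' ↦ (c/4) x'` in the first block on the unit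
  ball (ball contraction of `RadialDiffeomorph.lean` after `8 •`), odd in the second block;
* `exists_isLocalDiffeomorphAt_core_ball`, `exists_injOn_core_ball`,
  `isSmoothEmbedding_core_comp_squeeze` — compact-ball forms of the tubular-neighbourhood theorem
  of `FramedTubularNbhd.lean` (Hirsch (1976), Ch. 4 §5): the tube map `core` of a normal framing of an
  immersion `ℝⁿ → Sⁿ⁺¹` injective on `B̄(0, R)` gives, after the squeeze, a smooth embedding
  `ℝⁿ⁺¹ ↪ Sⁿ⁺¹` which is an open map;
* `Surgery.lastReflection` (`r`, reflection of `ℝⁿ⁺¹` in the last coordinate, `det r = -1`),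
  `Surgery.eqReflection` (`R`, reflection of `Sⁿ⁺¹` in `{v₁ = 0}`), `squeeze_lastReflection`;
* `isNormalFraming_of_unitNormal`, `isNormalFraming_stdDisc` (the constant field `e₁` frames the
  standard disc), `core_eq_core_std` (the two tube maps agree where `φ = φ'`, `ν = e₁`),
  `core_std_neg` (`core' (y, -u) = R (core' (y, u))`);
* **`exists_diffeomorph_cerfPalais`** — for the surgery disc data: a diffeomorphism `F'` of
  `Sⁿ⁺¹` and an open `W ⊇ S_L = {z = 0} = ∂Δ₁` with `F' = id` on `W` and `F'(φ(2𝔻ⁿ)) = φ'(2𝔻ⁿ)`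
  (`= H̄₊`).  The discs `î = core ∘ squeeze 12 ε`, `î' = core' ∘ squeeze 12 ε` agree on
  `O = {‖x‖ < 1, ‖x'‖ > 1/3}`, carry `S = {x'' = 0, ‖x'‖ ≤ 2/3} ⊆ 𝔻ⁿ⁺¹` onto `φ(2𝔻ⁿ)`, `φ'(2𝔻ⁿ)`,
  and `î' ∘ r = R ∘ î'`; the disc theorem gives `F ∘ î = î'` on `𝔻ⁿ⁺¹` (then `F = id` on
  `W = î(O)`) or `F ∘ î ∘ r = î'` (then `F = R` on `î(O)` and `F' = R ∘ F`).

Everything here is proved; the definitions are explicit; no named facts are introduced.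

## References

* R. Budney, D. Gabai, *Knotted 3-balls in `S⁴`*, arXiv:1912.09029 (v2), §3, Thm. 3.12 and the
  remark following it, proof of Thm. 3.13 (p. 22). [BudneyGabai2019]
* M. W. Hirsch, *Differential Topology*, GTM 33 (1976), Ch. 4 §5 (tubular neighbourhoods), Ch. 8 §3,
  Thm. 3.1 (disc theorem). [HirschDT1976]
* R. Palais, *Extending diffeomorphisms*, Proc. AMS 11 (1960), Thm. B; J. Cerf, *Topologie de
  certains espaces de plongements*, Bull. SMF 89 (1961). [Palais1960]
-/

noncomputable section

open scoped Manifold ContDiff Topology Real RealInnerProductSpace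
open Set Function Metric Module

/-- Local notation: Euclidean model space. -/
local notation "𝔼 " n:arg => EuclideanSpace ℝ (Fin n)
/-- Local notation: the unit sphere `Sⁿ ⊆ ℝⁿ⁺¹`. -/
local notation "𝕊 " n:arg => (Metric.sphere (0 : EuclideanSpace ℝ (Fin (n + 1))) 1)

namespace Literature.Topology.FourManifolds

namespace BudneyGabai2019_thm_3_13

namespace Surgery

attribute [local instance] fact_finrank_euclideanSpace_succ

variable (n : ℕ)

/-! ### Splitting `ℝⁿ⁺¹ = ℝⁿ × ℝ¹` -/

/-- The splitting `x ↦ ((x₀, …, xₙ₋₁), (xₙ))` of `ℝⁿ⁺¹` into `ℝⁿ × ℝ¹`, as a linear equivalence.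
[folklore] -/
def splitL : 𝔼 (n + 1) ≃ₗ[ℝ] (𝔼 n × 𝔼 1) where
  toFun x := (WithLp.toLp 2 fun j : Fin n ↦ x j.castSucc, WithLp.toLp 2 fun _ : Fin 1 ↦ x (Fin.last n))
  invFun q := WithLp.toLp 2 (Fin.snoc (⇑q.1) (q.2 0))
  map_add' x y := by
    refine Prod.ext ?_ ?_ <;> ext <;> simp
  map_smul' c x := by
    refine Prod.ext ?_ ?_ <;> ext <;> simp
  left_inv x := by
    ext i
    refine Fin.lastCases ?_ (fun j ↦ ?_) i
    · simp
    · simp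
  right_inv q := by
    refine Prod.ext ?_ ?_
    · ext j; simp
    · ext i
      have hi : i = 0 := Subsingleton.elim _ _
      subst hi
      simp

/-- The splitting `ℝⁿ⁺¹ ≃ ℝⁿ × ℝ¹` as a continuous linear equivalence. [folklore] -/
def split : 𝔼 (n + 1) ≃L[ℝ] (𝔼 n × 𝔼 1) := (splitL n).toContinuousLinearEquiv

/-- First block of the splitting. [folklore] -/
@[simp] theorem split_apply_fst (x : 𝔼 (n + 1)) (j : Fin n) : (split n x).1 j = x j.castSucc := rfl

/-- Second block of the splitting. [folklore] -/
@[simp] theorem split_apply_snd (x : 𝔼 (n + 1)) (i : Fin 1) : (split n x).2 i = x (Fin.last n) := rfl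

/-- The inverse of the splitting. [folklore] -/
theorem split_symm_apply (q : 𝔼 n × 𝔼 1) :
    (split n).symm q = WithLp.toLp 2 (Fin.snoc (⇑q.1) (q.2 0)) := rfl

/-- **Pythagoras for the splitting**: `‖x‖² = ‖x'‖² + ‖x''‖²`. [folklore] -/
theorem norm_sq_eq_split (x : 𝔼 (n + 1)) : ‖x‖ ^ 2 = ‖(split n x).1‖ ^ 2 + ‖(split n x).2‖ ^ 2 := by
  rw [EuclideanSpace.real_norm_sq_eq, EuclideanSpace.real_norm_sq_eq, EuclideanSpace.real_norm_sq_eq,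
    Fin.sum_univ_castSucc]
  simp

/-- The first block is shorter than the vector. [folklore] -/
theorem norm_split_fst_le (x : 𝔼 (n + 1)) : ‖(split n x).1‖ ≤ ‖x‖ := by
  have h := norm_sq_eq_split n x
  nlinarith [norm_nonneg x, norm_nonneg (split n x).1, sq_nonneg ‖(split n x).2‖]

/-- The second block is shorter than the vector. [folklore] -/
theorem norm_split_snd_le (x : 𝔼 (n + 1)) : ‖(split n x).2‖ ≤ ‖x‖ := by
  have h := norm_sq_eq_split n x
  nlinarith [norm_nonneg x, norm_nonneg (split n x).2, sq_nonneg ‖(split n x).1‖]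

/-! ### The scaled ball contraction and its oddness -/

/-- A radial map is odd. [folklore] -/
theorem radialMap_neg {E : Type*} [NormedAddCommGroup E] [InnerProductSpace ℝ E] (φ : ℝ → ℝ)
    (z : E) : radialMap φ (-z) = -radialMap φ z := by
  rw [radialMap, radialMap, norm_neg, smul_neg]

/-- The ball contraction is odd. [folklore] -/
theorem ballContraction_neg {E : Type*} [NormedAddCommGroup E] [InnerProductSpace ℝ E] (z : E) :
    ballContraction (-z) = -ballContraction z :=
  radialMap_neg _ _

/-! ### The squeeze `A : ℝⁿ⁺¹ → B(0, c) × B(0, ε) ⊆ ℝⁿ × ℝ¹` -/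

/-- The ball contraction is linear, `g w = w/32`, on the CLOSED ball of radius `8` (the tree's
`ballContraction_eq_smul_of_norm_lt` is the open version). [folklore] -/
theorem ballContraction_eq_smul_of_norm_le {E : Type*} [NormedAddCommGroup E] [InnerProductSpace ℝ E]
    {w : E} (hw : ‖w‖ ≤ 8) : ballContraction w = (32 : ℝ)⁻¹ • w := by
  rcases eq_or_ne w 0 with rfl | hw0
  · rw [ballContraction_zero, smul_zero]
  · rw [ballContraction, radialMap, ballProfile_of_le hw]
    congr 1
    field_simp [norm_ne_zero_iff.2 hw0]

/-- **The squeeze** `A_{c,ε} x = (c g(8 x'), ε g(x''))`, `g` the ball contraction: a diffeomorphism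
of `ℝⁿ⁺¹` onto the product of balls `B(0, c) × B(0, ε)`, linear in the first block,
`x' ↦ (c/4) x'`, for `‖x'‖ ≤ 1`. [folklore] -/
def squeeze (c ε : ℝ) (x : 𝔼 (n + 1)) : 𝔼 n × 𝔼 1 :=
  (c • ballContraction ((8 : ℝ) • (split n x).1), ε • ballContraction (split n x).2)

/-- The inverse of the squeeze on `B(0, c) × B(0, ε)`. [folklore] -/
def unsqueeze (c ε : ℝ) (q : 𝔼 n × 𝔼 1) : 𝔼 (n + 1) :=
  (split n).symm ((8 : ℝ)⁻¹ • ballContractionInv (c⁻¹ • q.1), ballContractionInv (ε⁻¹ • q.2))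

variable {n}

/-- Unfolding of the squeeze. [folklore] -/
theorem squeeze_apply (c ε : ℝ) (x : 𝔼 (n + 1)) :
    squeeze n c ε x =
      (c • ballContraction ((8 : ℝ) • (split n x).1), ε • ballContraction (split n x).2) := rfl

/-- **The squeeze is linear in the first block on the unit ball**: `(A x)' = (c/4) x'` for
`‖x'‖ ≤ 1`. [folklore] -/
theorem squeeze_fst_eq (c ε : ℝ) {x : 𝔼 (n + 1)} (hx : ‖(split n x).1‖ ≤ 1) :
    (squeeze n c ε x).1 = (c / 4) • (split n x).1 := by
  have h8 : ‖(8 : ℝ) • (split n x).1‖ ≤ 8 := by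
    rw [norm_smul, Real.norm_ofNat]; linarith
  rw [squeeze_apply]
  show c • ballContraction ((8 : ℝ) • (split n x).1) = (c / 4) • (split n x).1
  rw [ballContraction_eq_smul_of_norm_le h8, smul_smul, smul_smul]
  congr 1
  ring

/-- The squeeze is smooth. [folklore] -/
theorem contDiff_squeeze (c ε : ℝ) : ContDiff ℝ ∞ (squeeze n c ε) :=
  ((contDiff_ballContraction.comp (((split n).contDiff.fst).const_smul (8 : ℝ))).const_smul c).prodMk
    ((contDiff_ballContraction.comp ((split n).contDiff.snd)).const_smul ε)

/-- The squeeze lands in `B(0, c) × B(0, ε)` (`c, ε > 0`). [folklore] -/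
theorem norm_squeeze_fst_lt {c : ℝ} (hc : 0 < c) (ε : ℝ) (x : 𝔼 (n + 1)) : ‖(squeeze n c ε x).1‖ < c := by
  rw [squeeze_apply, norm_smul, Real.norm_of_nonneg hc.le]
  have := norm_ballContraction_lt_one ((8 : ℝ) • (split n x).1)
  nlinarith

/-- The squeeze lands in `B(0, c) × B(0, ε)` (`c, ε > 0`). [folklore] -/
theorem norm_squeeze_snd_lt (c : ℝ) {ε : ℝ} (hε : 0 < ε) (x : 𝔼 (n + 1)) : ‖(squeeze n c ε x).2‖ < ε := by
  rw [squeeze_apply, norm_smul, Real.norm_of_nonneg hε.le]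
  have := norm_ballContraction_lt_one (split n x).2
  nlinarith

/-- `unsqueeze ∘ squeeze = id` (`c, ε ≠ 0`). [folklore] -/
theorem unsqueeze_squeeze {c ε : ℝ} (hc : c ≠ 0) (hε : ε ≠ 0) (x : 𝔼 (n + 1)) :
    unsqueeze n c ε (squeeze n c ε x) = x := by
  rw [unsqueeze, squeeze_apply]
  simp only [smul_smul, inv_mul_cancel₀ hc, inv_mul_cancel₀ hε, one_smul,
    ballContractionInv_ballContraction, inv_mul_cancel₀ (by norm_num : (8 : ℝ) ≠ 0), Prod.mk.eta]
  exact (split n).symm_apply_apply x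

/-- `squeeze ∘ unsqueeze = id` on `B(0, c) × B(0, ε)` (`c, ε > 0`). [folklore] -/
theorem squeeze_unsqueeze {c ε : ℝ} (hc : 0 < c) (hε : 0 < ε) {q : 𝔼 n × 𝔼 1} (h1 : ‖q.1‖ < c)
    (h2 : ‖q.2‖ < ε) : squeeze n c ε (unsqueeze n c ε q) = q := by
  have h1' : ‖c⁻¹ • q.1‖ < 1 := by
    rw [norm_smul, norm_inv, Real.norm_of_nonneg hc.le]
    rwa [inv_mul_lt_iff₀ hc, mul_one]
  have h2' : ‖ε⁻¹ • q.2‖ < 1 := by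
    rw [norm_smul, norm_inv, Real.norm_of_nonneg hε.le]
    rwa [inv_mul_lt_iff₀ hε, mul_one]
  rw [unsqueeze, squeeze_apply, (split n).apply_symm_apply]
  simp only [smul_smul, mul_inv_cancel₀ (by norm_num : (8 : ℝ) ≠ 0), one_smul,
    ballContraction_ballContractionInv h1', ballContraction_ballContractionInv h2',
    mul_inv_cancel₀ hc.ne', mul_inv_cancel₀ hε.ne', Prod.mk.eta]

/-- The squeeze is injective (`c, ε ≠ 0`). [folklore] -/
theorem injective_squeeze {c ε : ℝ} (hc : c ≠ 0) (hε : ε ≠ 0) : Injective (squeeze n c ε) :=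
  LeftInverse.injective (unsqueeze_squeeze hc hε)

/-- `unsqueeze` is smooth on `B(0, c) × B(0, ε)`. [folklore] -/
theorem contDiffOn_unsqueeze {c ε : ℝ} (hc : 0 < c) (hε : 0 < ε) :
    ContDiffOn ℝ ∞ (unsqueeze n c ε) ({q : 𝔼 n × 𝔼 1 | ‖q.1‖ < c} ∩ {q | ‖q.2‖ < ε}) := by
  intro q hq
  have h1' : ‖c⁻¹ • q.1‖ < 1 := by
    rw [norm_smul, norm_inv, Real.norm_of_nonneg hc.le, inv_mul_lt_iff₀ hc, mul_one]; exact hq.1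
  have h2' : ‖ε⁻¹ • q.2‖ < 1 := by
    rw [norm_smul, norm_inv, Real.norm_of_nonneg hε.le, inv_mul_lt_iff₀ hε, mul_one]; exact hq.2
  have hA : ContDiffAt ℝ ∞ (fun q : 𝔼 n × 𝔼 1 ↦ (8 : ℝ)⁻¹ • ballContractionInv (c⁻¹ • q.1)) q :=
    ((contDiffAt_ballContractionInv h1').comp q (contDiff_fst.const_smul _).contDiffAt).const_smul _
  have hB : ContDiffAt ℝ ∞ (fun q : 𝔼 n × 𝔼 1 ↦ ballContractionInv (ε⁻¹ • q.2)) q :=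
    (contDiffAt_ballContractionInv h2').comp q (contDiff_snd.const_smul _).contDiffAt
  exact ((split n).symm.contDiff.contDiffAt.comp q (hA.prodMk hB)).contDiffWithinAt

/-- **The squeeze as a global partial diffeomorphism** `ℝⁿ⁺¹ ≃ B(0, c) × B(0, ε)`. [folklore] -/
def squeezePD {c ε : ℝ} (hc : 0 < c) (hε : 0 < ε) :
    PartialDiffeomorph 𝓘(ℝ, 𝔼 (n + 1)) (𝓘(ℝ, 𝔼 n).prod 𝓘(ℝ, 𝔼 1)) (𝔼 (n + 1)) (𝔼 n × 𝔼 1) ∞ where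
  toFun := squeeze n c ε
  invFun := unsqueeze n c ε
  source := univ
  target := {q : 𝔼 n × 𝔼 1 | ‖q.1‖ < c} ∩ {q | ‖q.2‖ < ε}
  map_source' x _ := ⟨norm_squeeze_fst_lt hc ε x, norm_squeeze_snd_lt c hε x⟩
  map_target' _ _ := mem_univ _
  left_inv' x _ := unsqueeze_squeeze hc.ne' hε.ne' x
  right_inv' _ hq := squeeze_unsqueeze hc hε hq.1 hq.2
  open_source := isOpen_univ
  open_target := (isOpen_lt (continuous_norm.comp continuous_fst) continuous_const).inter
    (isOpen_lt (continuous_norm.comp continuous_snd) continuous_const)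
  contMDiffOn_toFun := by
    have h1 : ContMDiff 𝓘(ℝ, 𝔼 (n + 1)) 𝓘(ℝ, 𝔼 n) ∞ (fun x ↦ (squeeze n c ε x).1) :=
      ((contDiff_squeeze c ε).fst).contMDiff
    have h2 : ContMDiff 𝓘(ℝ, 𝔼 (n + 1)) 𝓘(ℝ, 𝔼 1) ∞ (fun x ↦ (squeeze n c ε x).2) :=
      ((contDiff_squeeze c ε).snd).contMDiff
    exact (h1.prodMk h2).contMDiffOn
  contMDiffOn_invFun := by
    have h := contDiffOn_unsqueeze (n := n) hc hε
    have h' : ContMDiffOn 𝓘(ℝ, 𝔼 n × 𝔼 1) 𝓘(ℝ, 𝔼 (n + 1)) ∞ (unsqueeze n c ε)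
        ({q : 𝔼 n × 𝔼 1 | ‖q.1‖ < c} ∩ {q | ‖q.2‖ < ε}) := h.contMDiffOn
    rw [modelWithCornersSelf_prod, ← chartedSpaceSelf_prod] at h'
    exact h'

/-- **The squeeze is a local diffeomorphism at every point.** [folklore] -/
theorem isLocalDiffeomorphAt_squeeze {c ε : ℝ} (hc : 0 < c) (hε : 0 < ε) (x : 𝔼 (n + 1)) :
    IsLocalDiffeomorphAt 𝓘(ℝ, 𝔼 (n + 1)) (𝓘(ℝ, 𝔼 n).prod 𝓘(ℝ, 𝔼 1)) ∞ (squeeze n c ε) x :=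
  PartialDiffeomorph.isLocalDiffeomorphAt 𝓘(ℝ, 𝔼 (n + 1)) (𝓘(ℝ, 𝔼 n).prod 𝓘(ℝ, 𝔼 1)) ∞
    (squeezePD hc hε) (mem_univ x)


/-! ### Uniform tubes over a compact ball (compact-subset forms of `FramedTubularNbhd`) -/

section Tube

variable {f : 𝔼 n → 𝕊 (n + 1)} {fr : Fin 1 → 𝔼 n → 𝔼 (n + 1 + 1)}
  (h : IsNormalFraming 𝓘(ℝ, 𝔼 n) f fr)
include h

/-- **The core map is a local diffeomorphism on a uniform tube over a compact ball**: for the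
normal framing of a smooth immersion `f : ℝⁿ → Sⁿ⁺¹` and every radius `R` there is `ε > 0` with
`core` a local diffeomorphism at all `(y, u)`, `‖y‖ ≤ R`, `‖u‖ < ε` (compactness of
`B̄(0, R) × {0}` inside the open local-diffeomorphism locus; cf.
`IsNormalFraming.exists_isLocalDiffeomorphAt_core` for compact sources). [folklore] -/
theorem exists_isLocalDiffeomorphAt_core_ball (hf : ContMDiff 𝓘(ℝ, 𝔼 n) (𝓡 (n + 1)) ∞ f)
    (hf' : ∀ y, Injective (mfderiv 𝓘(ℝ, 𝔼 n) (𝓡 (n + 1)) f y)) (R : ℝ) :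
    ∃ ε > 0, ∀ q : 𝔼 n × 𝔼 1, ‖q.1‖ ≤ R → ‖q.2‖ < ε →
      IsLocalDiffeomorphAt (𝓘(ℝ, 𝔼 n).prod 𝓘(ℝ, 𝔼 1)) (𝓡 (n + 1)) ∞ h.core q := by
  have hdim : Module.finrank ℝ (𝔼 n) + 1 = n + 1 := by rw [finrank_euclideanSpace_fin]
  have hopen := isOpen_setOf_isLocalDiffeomorphAt (I := 𝓘(ℝ, 𝔼 n).prod 𝓘(ℝ, 𝔼 1))
    (J := 𝓡 (n + 1)) (n := ∞) h.core
  have hsub : closedBall (0 : 𝔼 n) R ×ˢ ({0} : Set (𝔼 1)) ⊆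
      {q | IsLocalDiffeomorphAt (𝓘(ℝ, 𝔼 n).prod 𝓘(ℝ, 𝔼 1)) (𝓡 (n + 1)) ∞ h.core q} := by
    rintro ⟨x, u⟩ ⟨-, hu⟩
    rw [mem_singleton_iff] at hu
    subst hu
    exact h.isLocalDiffeomorphAt_core_zero hf hf' hdim x
  obtain ⟨U, V, -, hV, hU, h0V, hUV⟩ :=
    generalized_tube_lemma (isCompact_closedBall (0 : 𝔼 n) R) isCompact_singleton hopen hsub
  obtain ⟨ε, hε, hball⟩ := Metric.isOpen_iff.1 hV 0 (h0V rfl)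
  exact ⟨ε, hε, fun q hq1 hq2 ↦ hUV ⟨hU (mem_closedBall_zero_iff.2 hq1), hball (mem_ball_zero_iff.2 hq2)⟩⟩

/-- **The core map is injective on a uniform tube over a compact ball on which `f` is
injective** (`exists_injOn_prod_ball` on the compact space `B̄(0, R)`). [folklore] -/
theorem exists_injOn_core_ball (hf : ContMDiff 𝓘(ℝ, 𝔼 n) (𝓡 (n + 1)) ∞ f)
    (hf' : ∀ y, Injective (mfderiv 𝓘(ℝ, 𝔼 n) (𝓡 (n + 1)) f y)) {R : ℝ}
    (hinj : InjOn f (closedBall 0 R)) :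
    ∃ ε > 0, InjOn h.core (closedBall (0 : 𝔼 n) R ×ˢ ball (0 : 𝔼 1) ε) := by
  have hdim : Module.finrank ℝ (𝔼 n) + 1 = n + 1 := by rw [finrank_euclideanSpace_fin]
  haveI : CompactSpace (closedBall (0 : 𝔼 n) R) :=
    isCompact_iff_compactSpace.1 (isCompact_closedBall 0 R)
  set g : closedBall (0 : 𝔼 n) R × 𝔼 1 → 𝕊 (n + 1) := fun p ↦ h.core ((p.1 : 𝔼 n), p.2) with hg
  have hgc : Continuous g :=
    (h.continuous_core hf).comp ((continuous_subtype_val.comp continuous_fst).prodMk continuous_snd)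
  have hg0 : Injective fun x : closedBall (0 : 𝔼 n) R ↦ g (x, 0) := by
    intro x x' hxx'
    have : f x = f x' := by simpa [hg, h.core_zero] using hxx'
    exact Subtype.ext (hinj x.2 x'.2 this)
  have hloc : ∀ x : closedBall (0 : 𝔼 n) R, ∃ U ∈ 𝓝 (x, (0 : 𝔼 1)), InjOn g U := by
    intro x
    obtain ⟨Φ, hx, heq⟩ := h.isLocalDiffeomorphAt_core_zero hf hf' hdim (x : 𝔼 n)
    have hcont : Continuous fun p : closedBall (0 : 𝔼 n) R × 𝔼 1 ↦ (((p.1 : 𝔼 n), p.2) : 𝔼 n × 𝔼 1) :=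
      (continuous_subtype_val.comp continuous_fst).prodMk continuous_snd
    refine ⟨(fun p : closedBall (0 : 𝔼 n) R × 𝔼 1 ↦ (((p.1 : 𝔼 n), p.2) : 𝔼 n × 𝔼 1)) ⁻¹' Φ.source,
      hcont.continuousAt.preimage_mem_nhds (Φ.open_source.mem_nhds hx), ?_⟩
    intro a ha b hb hab
    have hab' : ((a.1 : 𝔼 n), a.2) = (((b.1 : 𝔼 n), b.2) : 𝔼 n × 𝔼 1) :=
      Φ.injOn ha hb (by rw [← heq ha, ← heq hb]; exact hab)
    obtain ⟨h1, h2⟩ := Prod.mk.inj hab'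
    exact Prod.ext (Subtype.ext h1) h2
  obtain ⟨ε, hε, hinjOn⟩ := exists_injOn_prod_ball hgc hg0 hloc
  refine ⟨ε, hε, ?_⟩
  rintro ⟨y, u⟩ ⟨hy, hu⟩ ⟨y', u'⟩ ⟨hy', hu'⟩ hyy
  have := @hinjOn (⟨y, hy⟩, u) ⟨mem_univ _, hu⟩ (⟨y', hy'⟩, u') ⟨mem_univ _, hu'⟩ hyy
  obtain ⟨h1, h2⟩ := Prod.mk.inj this
  exact Prod.ext (congrArg Subtype.val h1) h2

/-- **The thickened disc is a smooth embedding of `ℝⁿ⁺¹`.**  For the normal framing of a smooth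
immersion `f : ℝⁿ → Sⁿ⁺¹` injective on `B̄(0, R)`, and `ε` below the radii of
`exists_isLocalDiffeomorphAt_core_ball`, `exists_injOn_core_ball`, the map
`core ∘ squeeze_{R,ε} : ℝⁿ⁺¹ → Sⁿ⁺¹` is an injective local diffeomorphism, hence a smooth
embedding (`isSmoothEmbedding_of_isLocalDiffeomorph`; Hirsch (1976), Ch. 4 §5, Thm. 5.1).
[folklore] -/
theorem isSmoothEmbedding_core_comp_squeeze {R ε ε₁ ε₂ : ℝ} (hR : 0 < R) (hε : 0 < ε)
    (hε₁ : ε ≤ ε₁) (hε₂ : ε ≤ ε₂)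
    (hloc : ∀ q : 𝔼 n × 𝔼 1, ‖q.1‖ ≤ R → ‖q.2‖ < ε₁ →
      IsLocalDiffeomorphAt (𝓘(ℝ, 𝔼 n).prod 𝓘(ℝ, 𝔼 1)) (𝓡 (n + 1)) ∞ h.core q)
    (hinjOn : InjOn h.core (closedBall (0 : 𝔼 n) R ×ˢ ball (0 : 𝔼 1) ε₂)) :
    Manifold.IsSmoothEmbedding 𝓘(ℝ, 𝔼 (n + 1)) (𝓡 (n + 1)) ∞ (h.core ∘ squeeze n R ε) ∧
      IsOpenMap (h.core ∘ squeeze n R ε) := by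
  have hld : IsLocalDiffeomorph 𝓘(ℝ, 𝔼 (n + 1)) (𝓡 (n + 1)) ∞ (h.core ∘ squeeze n R ε) := by
    intro x
    exact (isLocalDiffeomorphAt_squeeze hR hε x).comp (K := 𝓡 (n + 1)) (P := 𝕊 (n + 1))
      (hloc _ (norm_squeeze_fst_lt hR ε x).le ((norm_squeeze_snd_lt R hε x).trans_le hε₁))
  have hinj : Injective (h.core ∘ squeeze n R ε) := by
    intro x x' hxx'
    refine injective_squeeze hR.ne' hε.ne' (hinjOn ?_ ?_ hxx')
    · exact ⟨mem_closedBall_zero_iff.2 (norm_squeeze_fst_lt hR ε x).le,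
        mem_ball_zero_iff.2 ((norm_squeeze_snd_lt R hε x).trans_le hε₂)⟩
    · exact ⟨mem_closedBall_zero_iff.2 (norm_squeeze_fst_lt hR ε x').le,
        mem_ball_zero_iff.2 ((norm_squeeze_snd_lt R hε x').trans_le hε₂)⟩
  exact ⟨isSmoothEmbedding_of_isLocalDiffeomorph hld hinj (ContinuousLinearEquiv.refl ℝ _),
    hld.isLocalHomeomorph.isOpenMap⟩

end Tube


/-! ### The reflections `r` (of `ℝⁿ⁺¹`, last coordinate) and `R` (of `Sⁿ⁺¹`, coordinate `1`) -/

variable (n) in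
/-- The last basis vector `e_last` of `ℝⁿ⁺¹`. [folklore] -/
def eLast : 𝔼 (n + 1) := EuclideanSpace.single (Fin.last n) 1

variable (n) in
/-- **The reflection `r` of `ℝⁿ⁺¹` in the hyperplane orthogonal to the last basis vector**
(`x ↦ (x', -x'')`), the orientation-reversing linear isometry of the unoriented disc theorem.
[folklore] -/
def lastReflection : 𝔼 (n + 1) ≃ₗᵢ[ℝ] 𝔼 (n + 1) := ((ℝ ∙ eLast n)ᗮ).reflection

/-- `r x = x - 2 x_last • e_last`. [folklore] -/
theorem lastReflection_apply (x : 𝔼 (n + 1)) :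
    lastReflection n x = x - (2 * x (Fin.last n)) • eLast n := by
  have hK : x - x (Fin.last n) • eLast n ∈ (ℝ ∙ eLast n)ᗮ := by
    rw [Submodule.mem_orthogonal_singleton_iff_inner_right, inner_sub_right, real_inner_smul_right]
    have h2 : ⟪eLast n, x⟫ = x (Fin.last n) := by simp [eLast, EuclideanSpace.inner_single_left]
    have h1 : ⟪eLast n, eLast n⟫ = 1 := by simp [eLast]
    rw [h2, h1, mul_one, sub_self]
  have hdec : x = (x - x (Fin.last n) • eLast n) + x (Fin.last n) • eLast n := by abel
  conv_lhs => rw [hdec]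
  rw [lastReflection, map_add, map_smul, Submodule.reflection_mem_subspace_eq_self hK,
    Submodule.reflection_orthogonalComplement_singleton_eq_neg]
  rw [smul_neg, two_mul, add_smul]
  abel

/-- The first block is fixed by `r`. [folklore] -/
@[simp] theorem split_lastReflection_fst (x : 𝔼 (n + 1)) :
    (split n (lastReflection n x)).1 = (split n x).1 := by
  ext j
  rw [split_apply_fst, split_apply_fst, lastReflection_apply]
  simp [eLast, Fin.castSucc_lt_last j |>.ne]

/-- The second block is negated by `r`. [folklore] -/
@[simp] theorem split_lastReflection_snd (x : 𝔼 (n + 1)) :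
    (split n (lastReflection n x)).2 = -(split n x).2 := by
  ext i
  rw [split_apply_snd, PiLp.neg_apply, split_apply_snd, lastReflection_apply]
  simp [eLast]
  ring

/-- `r` has determinant `-1 < 0`. [folklore] -/
theorem det_lastReflection_neg :
    LinearMap.det ((lastReflection n).toContinuousLinearEquiv.toLinearEquiv :
      𝔼 (n + 1) →ₗ[ℝ] 𝔼 (n + 1)) < 0 := by
  have he0 : eLast n ≠ 0 := by
    intro h
    have := congrArg (fun x : 𝔼 (n + 1) ↦ x (Fin.last n)) h
    simp [eLast] at this
  have h := ((ℝ ∙ eLast n)ᗮ).det_reflection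
  rw [Submodule.orthogonal_orthogonal, finrank_span_singleton he0, pow_one] at h
  have h' : LinearMap.det ((lastReflection n).toContinuousLinearEquiv.toLinearEquiv :
      𝔼 (n + 1) →ₗ[ℝ] 𝔼 (n + 1)) = -1 := h
  rw [h']
  norm_num

/-- **The squeeze intertwines `r` with the fibre reflection** `(y, u) ↦ (y, -u)` (the ball
contraction is odd). [folklore] -/
theorem squeeze_lastReflection (c ε : ℝ) (x : 𝔼 (n + 1)) :
    squeeze n c ε (lastReflection n x) = ((squeeze n c ε x).1, -(squeeze n c ε x).2) := by
  rw [squeeze_apply, squeeze_apply, split_lastReflection_fst, split_lastReflection_snd,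
    ballContraction_neg, smul_neg]

variable (n) in
/-- The point `e₁ ∈ Sⁿ⁺¹`. [folklore] -/
def eOne : 𝕊 (n + 1) := ⟨EuclideanSpace.single 1 1, by simp [PiLp.norm_single]⟩

/-- Coordinates of `e₁`. [folklore] -/
@[simp] theorem coe_eOne : (eOne n : 𝔼 (n + 1 + 1)) = EuclideanSpace.single 1 1 := rfl

variable (n) in
/-- **The reflection `R` of `Sⁿ⁺¹` in the equatorial great sphere `{v₁ = 0}`** (`v₁ ↦ -v₁`).
[folklore] -/
abbrev eqReflection : (𝕊 (n + 1)) ≃ₘ⟮𝓡 (n + 1), 𝓡 (n + 1)⟯ (𝕊 (n + 1)) :=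
  poleReflectionSphere (n := n + 1) (eOne n)

/-- `R` fixes the vectors of the hyperplane `{v₁ = 0}`. [folklore] -/
theorem poleReflection_eOne_of_apply_one {w : 𝔼 (n + 1 + 1)} (hw : w 1 = 0) :
    poleReflection (eOne n) w = w := by
  apply Submodule.reflection_mem_subspace_eq_self
  rw [Submodule.mem_orthogonal_singleton_iff_inner_right, coe_eOne, EuclideanSpace.inner_single_left]
  simp [hw]

/-- `R` fixes the points of the equatorial great sphere `{v₁ = 0}`. [folklore] -/
theorem eqReflection_of_apply_one {v : 𝕊 (n + 1)} (hv : (v : 𝔼 (n + 1 + 1)) 1 = 0) :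
    eqReflection n v = v :=
  Subtype.ext (poleReflection_eOne_of_apply_one hv)

/-- `R` is an involution. [folklore] -/
theorem eqReflection_eqReflection (v : 𝕊 (n + 1)) : eqReflection n (eqReflection n v) = v :=
  poleReflectionSphere_poleReflectionSphere _ _

/-! ### The two framings and the two discs -/

section Discs

variable {φ : 𝔼 n → 𝕊 (n + 1)} {ν : 𝔼 n → 𝔼 (n + 1 + 1)}

/-- **The unit normal field is a normal framing** of the surgery disc (one normal field,
`dim ℝⁿ + 1 = n + 1`). [folklore] -/
theorem isNormalFraming_of_unitNormal (hν : ContDiff ℝ ∞ ν) (hν1 : ∀ y, ‖ν y‖ = 1)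
    (hνφ : ∀ y, ⟪ν y, (φ y : 𝔼 (n + 1 + 1))⟫ = 0)
    (hνd : ∀ y ξ, ⟪ν y, fderiv ℝ (fun y ↦ (φ y : 𝔼 (n + 1 + 1))) y ξ⟫ = 0) :
    IsNormalFraming 𝓘(ℝ, 𝔼 n) φ (fun _ : Fin 1 ↦ ν) where
  contMDiff _ := hν.contMDiff
  inner_eq_zero _ y := hνφ y
  eq_zero_of_eq y v a h := by
    have h' : fderiv ℝ (fun y ↦ (φ y : 𝔼 (n + 1 + 1))) y v + a 0 • ν y = 0 := by
      rw [ambientDeriv_apply, mfderiv_eq_fderiv, Fin.sum_univ_one] at h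
      exact h
    have h2 := congrArg (fun w ↦ ⟪ν y, w⟫) h'
    simp only [inner_add_right, real_inner_smul_right, hνd, real_inner_self_eq_norm_sq, hν1,
      inner_zero_right] at h2
    have ha : a 0 = 0 := by nlinarith [h2]
    funext i
    rw [Subsingleton.elim i 0, ha]
    rfl

/-- The standard disc has values in the hyperplane `{v₁ = 0}`, hence so has its derivative.
[folklore] -/
theorem fderiv_coe_stdDisc_apply_one (y v : 𝔼 n) :
    fderiv ℝ (fun y ↦ (stdDisc n y : 𝔼 (n + 1 + 1))) y v 1 = 0 := by
  set Ψ : 𝔼 n → 𝔼 (n + 1 + 1) := fun y ↦ (stdDisc n y : 𝔼 (n + 1 + 1)) with hΨ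
  have hΨd : DifferentiableAt ℝ Ψ y :=
    ((contMDiff_iff_contDiff.1 ((contMDiff_coe_sphere (m := ∞)).comp (contMDiff_stdDisc n))).differentiable
      (by simp)) y
  have hcomp : (fun y ↦ Ψ y 1) =
      ⇑(EuclideanSpace.proj (1 : Fin (n + 1 + 1)) : 𝔼 (n + 1 + 1) →L[ℝ] ℝ) ∘ Ψ := rfl
  have h1 : fderiv ℝ (fun y ↦ Ψ y 1) y =
      (EuclideanSpace.proj (1 : Fin (n + 1 + 1)) : 𝔼 (n + 1 + 1) →L[ℝ] ℝ).comp (fderiv ℝ Ψ y) := by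
    rw [hcomp]
    exact ((EuclideanSpace.proj (1 : Fin (n + 1 + 1)) :
      𝔼 (n + 1 + 1) →L[ℝ] ℝ).hasFDerivAt.comp y hΨd.hasFDerivAt).fderiv
  have h0 : fderiv ℝ (fun y ↦ Ψ y 1) y = 0 := by
    rw [show (fun y ↦ Ψ y 1) = fun _ ↦ (0 : ℝ) from funext fun y ↦ coe_stdDisc_apply_one n y]
    simp
  have := congrArg (fun L : 𝔼 n →L[ℝ] ℝ ↦ L v) (h0.symm.trans h1)
  simpa using this.symm

/-- **The constant field `e₁` is a normal framing of the standard disc.** [folklore] -/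
theorem isNormalFraming_stdDisc :
    IsNormalFraming 𝓘(ℝ, 𝔼 n) (stdDisc n)
      (fun (_ : Fin 1) (_ : 𝔼 n) ↦ EuclideanSpace.single (1 : Fin (n + 1 + 1)) (1 : ℝ)) where
  contMDiff _ := contMDiff_const
  inner_eq_zero _ y := by
    rw [EuclideanSpace.inner_single_left]; simp
  eq_zero_of_eq y v a h := by
    have h' : fderiv ℝ (fun y ↦ (stdDisc n y : 𝔼 (n + 1 + 1))) y v +
        a 0 • EuclideanSpace.single (1 : Fin (n + 1 + 1)) (1 : ℝ) = 0 := by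
      rw [ambientDeriv_apply, mfderiv_eq_fderiv, Fin.sum_univ_one] at h
      exact h
    have h2 := congrArg (fun w : 𝔼 (n + 1 + 1) ↦ w 1) h'
    have ha : a 0 = 0 := by simpa [fderiv_coe_stdDisc_apply_one] using h2
    funext i
    rw [Subsingleton.elim i 0, ha]
    rfl

variable (hfr : IsNormalFraming 𝓘(ℝ, 𝔼 n) φ (fun _ : Fin 1 ↦ ν))

/-- The core map of a one-field framing, read in `ℝⁿ⁺²`. [folklore] -/
theorem coe_core_one {f : 𝔼 n → 𝕊 (n + 1)} {g : 𝔼 n → 𝔼 (n + 1 + 1)}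
    (h : IsNormalFraming 𝓘(ℝ, 𝔼 n) f (fun _ : Fin 1 ↦ g)) (q : 𝔼 n × 𝔼 1) :
    (h.core q : 𝔼 (n + 1 + 1)) =
      (‖(f q.1 : 𝔼 (n + 1 + 1)) + q.2 0 • g q.1‖)⁻¹ • ((f q.1 : 𝔼 (n + 1 + 1)) + q.2 0 • g q.1) := by
  rw [h.coe_core, framingAff_apply, framingSpan_apply, Fin.sum_univ_one]

include hfr in
/-- **Where the surgery disc is standard, the two core maps agree**: for `1 < ‖y‖` (where
`φ = φ'` and `ν = e₁`). [folklore] -/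
theorem core_eq_core_std (hφstd : ∀ y : 𝔼 n, 1 ≤ ‖y‖ → φ y = stdDisc n y)
    (hνstd : ∀ y : 𝔼 n, 1 < ‖y‖ → ν y = EuclideanSpace.single (1 : Fin (n + 1 + 1)) (1 : ℝ))
    {q : 𝔼 n × 𝔼 1} (hq : 1 < ‖q.1‖) :
    hfr.core q = (isNormalFraming_stdDisc (n := n)).core q := by
  apply Subtype.ext
  rw [coe_core_one hfr, coe_core_one isNormalFraming_stdDisc, hφstd q.1 hq.le, hνstd q.1 hq]

/-- **The standard core map is `R`-equivariant**: `core' (y, -u) = R (core' (y, u))` (`R` fixes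
`φ' y ∈ {v₁ = 0}` and negates `e₁`; it is a linear isometry). [folklore] -/
theorem core_std_neg (q : 𝔼 n × 𝔼 1) :
    (isNormalFraming_stdDisc (n := n)).core (q.1, -q.2) =
      eqReflection n ((isNormalFraming_stdDisc (n := n)).core q) := by
  apply Subtype.ext
  show ((isNormalFraming_stdDisc (n := n)).core (q.1, -q.2) : 𝔼 (n + 1 + 1)) =
    poleReflection (eOne n) ((isNormalFraming_stdDisc (n := n)).core q : 𝔼 (n + 1 + 1))
  rw [coe_core_one, coe_core_one]
  dsimp only
  have hfix : poleReflection (eOne n) (stdDisc n q.1 : 𝔼 (n + 1 + 1)) = stdDisc n q.1 :=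
    poleReflection_eOne_of_apply_one (coe_stdDisc_apply_one n q.1)
  have hneg : poleReflection (eOne n) (EuclideanSpace.single (1 : Fin (n + 1 + 1)) (1 : ℝ)) =
      -EuclideanSpace.single (1 : Fin (n + 1 + 1)) (1 : ℝ) := poleReflection_apply_pole (eOne n)
  have hlin : poleReflection (eOne n) ((stdDisc n q.1 : 𝔼 (n + 1 + 1)) +
      q.2 0 • EuclideanSpace.single (1 : Fin (n + 1 + 1)) (1 : ℝ)) =
      (stdDisc n q.1 : 𝔼 (n + 1 + 1)) + (-q.2) 0 • EuclideanSpace.single (1 : Fin (n + 1 + 1)) (1 : ℝ) := by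
    rw [map_add, map_smul, hfix, hneg, PiLp.neg_apply, smul_neg, neg_smul]
  rw [map_smul, ← LinearIsometryEquiv.norm_map (poleReflection (eOne n))
    ((stdDisc n q.1 : 𝔼 (n + 1 + 1)) + q.2 0 • EuclideanSpace.single (1 : Fin (n + 1 + 1)) (1 : ℝ)), hlin]

end Discs


/-! ### The Cerf–Palais step: the disc theorem in `Sⁿ⁺¹` -/

section CerfPalais

variable {φ : 𝔼 n → 𝕊 (n + 1)} {ν : 𝔼 n → 𝔼 (n + 1 + 1)}

/-- The sphere `Sⁿ⁺¹` (`n + 1 ≥ 1`) is connected. [folklore] -/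
theorem connectedSpace_sphere_succ : ConnectedSpace (𝕊 (n + 1)) := by
  refine isConnected_iff_connectedSpace.mp (isConnected_sphere ?_ 0 zero_le_one)
  rw [← Module.finrank_eq_rank, finrank_euclideanSpace_fin]
  exact_mod_cast Nat.succ_lt_succ (Nat.succ_pos n)

/-- **The Cerf–Palais step of Budney–Gabai's proof of Thm. 3.13** (remark after Thm. 3.12,
arXiv:1912.09029 v2, p. 22: *"By the Cerf–Palais theorem there is a diffeomorphism of this sphere
taking `Δ₁` to a standard `n`-ball fixing `∂Δ₁` pointwise"*), in the relative form needed to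
descend to `S¹ × Sⁿ`: for the surgery disc `φ` (a smooth immersion `ℝⁿ → Sⁿ⁺¹`, injective on
`B̄(0, 12)`, equal to the standard disc `φ'` for `‖y‖ ≥ 1`) with a unit normal field `ν` equal
to `e₁` for `‖y‖ > 1`, there are a diffeomorphism `F'` of `Sⁿ⁺¹` and an open set `W` containing
the great sphere `S_L = {z = 0} = ∂Δ₁` such that `F' = id` on `W` and
`F'(φ(2𝔻ⁿ)) = φ'(2𝔻ⁿ) = H̄₊`.  Proof: thicken `φ` and `φ'` along the framings to discs
`î, î' : ℝⁿ⁺¹ ↪ Sⁿ⁺¹` (tubular neighbourhoods, `FramedTubularNbhd.lean`; squeezed by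
`squeeze 12 ε`) which AGREE on the open set `O = {‖x‖ < 1, ‖x'‖ > 1/3} ∋ î⁻¹(S_L)`; the disc
theorem of Palais–Cerf (`exists_diffeomorph_apply_disc_eq_or_reflect_cs`; Hirsch (1976),
Ch. 8 §3, Thm. 3.1) gives `F ∈ Diff(Sⁿ⁺¹)` with `F ∘ î = î'` on `𝔻ⁿ⁺¹` — so `F = id` on `î(O)` —
or `F ∘ î ∘ r = î'` with the reflection `r` in the last coordinate, in which case `F = R` on
`î(O)` for the reflection `R` of `Sⁿ⁺¹` in `{v₁ = 0}` (because `î' ∘ r = R ∘ î'`) and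
`F' := R ∘ F` works (`R` fixes `H̄₊ ⊆ {v₁ = 0}`).
[cite: BudneyGabai2019, Thm. 3.12, remark, and proof of Thm. 3.13 (arXiv:1912.09029 v2, p. 22); HirschDT1976, Ch. 8 §3 Thm. 3.1] -/
theorem exists_diffeomorph_cerfPalais
    (hφ : ContMDiff 𝓘(ℝ, 𝔼 n) (𝓡 (n + 1)) ∞ φ)
    (hφimm : ∀ y, Injective (mfderiv 𝓘(ℝ, 𝔼 n) (𝓡 (n + 1)) φ y))
    (hφinj : InjOn φ (closedBall 0 12))
    (hφstd : ∀ y : 𝔼 n, 1 ≤ ‖y‖ → φ y = stdDisc n y)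
    (hν : ContDiff ℝ ∞ ν) (hν1 : ∀ y, ‖ν y‖ = 1)
    (hνφ : ∀ y, ⟪ν y, (φ y : 𝔼 (n + 1 + 1))⟫ = 0)
    (hνd : ∀ y ξ, ⟪ν y, fderiv ℝ (fun y ↦ (φ y : 𝔼 (n + 1 + 1))) y ξ⟫ = 0)
    (hνstd : ∀ y : 𝔼 n, 1 < ‖y‖ → ν y = EuclideanSpace.single (1 : Fin (n + 1 + 1)) (1 : ℝ)) :
    ∃ (F : (𝕊 (n + 1)) ≃ₘ⟮𝓡 (n + 1), 𝓡 (n + 1)⟯ (𝕊 (n + 1))) (W : Set (𝕊 (n + 1))),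
      IsOpen W ∧ {v : 𝕊 (n + 1) | zc n (v : 𝔼 (n + 1 + 1)) = 0} ⊆ W ∧ (∀ w ∈ W, F w = w) ∧
      F '' (φ '' closedBall 0 2) = stdDisc n '' closedBall 0 2 := by
  haveI : ConnectedSpace (𝕊 (n + 1)) := connectedSpace_sphere_succ
  -- ### the two framings, their uniform tubes, and the two discs
  have hfr := isNormalFraming_of_unitNormal hν hν1 hνφ hνd
  have hfr' := isNormalFraming_stdDisc (n := n)
  have hstds := contMDiff_stdDisc n
  have hstdimm := mfderiv_stdDisc_injective n
  obtain ⟨ε₁, hε₁, hloc⟩ := exists_isLocalDiffeomorphAt_core_ball hfr hφ hφimm 12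
  obtain ⟨ε₂, hε₂, hinjc⟩ := exists_injOn_core_ball hfr hφ hφimm hφinj
  obtain ⟨ε₃, hε₃, hloc'⟩ := exists_isLocalDiffeomorphAt_core_ball hfr' hstds hstdimm 12
  obtain ⟨ε₄, hε₄, hinjc'⟩ := exists_injOn_core_ball hfr' hstds hstdimm
    ((injective_stdDisc n).injOn)
  set ε := min (min ε₁ ε₂) (min ε₃ ε₄) with hεdef
  have hε : 0 < ε := lt_min (lt_min hε₁ hε₂) (lt_min hε₃ hε₄)
  have h12 : (0 : ℝ) < 12 := by norm_num
  obtain ⟨hi, hiopen⟩ := isSmoothEmbedding_core_comp_squeeze hfr h12 hε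
    ((min_le_left _ _).trans (min_le_left _ _)) ((min_le_left _ _).trans (min_le_right _ _)) hloc hinjc
  obtain ⟨hi', -⟩ := isSmoothEmbedding_core_comp_squeeze hfr' h12 hε
    ((min_le_right _ _).trans (min_le_left _ _)) ((min_le_right _ _).trans (min_le_right _ _)) hloc' hinjc'
  set i : 𝔼 (n + 1) → 𝕊 (n + 1) := hfr.core ∘ squeeze n 12 ε with hidef
  set i' : 𝔼 (n + 1) → 𝕊 (n + 1) := hfr'.core ∘ squeeze n 12 ε with hi'def
  -- ### agreement on `O`, equivariance, the set `S`
  have hsq3 : ∀ x : 𝔼 (n + 1), ‖x‖ ≤ 1 → (squeeze n 12 ε x).1 = (3 : ℝ) • (split n x).1 := by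
    intro x hx
    rw [squeeze_fst_eq 12 ε ((norm_split_fst_le n x).trans hx)]
    norm_num
  have hagree : ∀ x : 𝔼 (n + 1), ‖x‖ ≤ 1 → 1 / 3 < ‖(split n x).1‖ → i x = i' x := by
    intro x hx hx3
    show hfr.core (squeeze n 12 ε x) = hfr'.core (squeeze n 12 ε x)
    apply core_eq_core_std hfr hφstd hνstd
    rw [hsq3 x hx, norm_smul, Real.norm_ofNat]
    linarith
  have hequiv : ∀ x : 𝔼 (n + 1), i' (lastReflection n x) = eqReflection n (i' x) := by
    intro x
    show hfr'.core (squeeze n 12 ε (lastReflection n x)) = eqReflection n (hfr'.core (squeeze n 12 ε x))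
    rw [squeeze_lastReflection]
    exact core_std_neg _
  -- points of `S = {x'' = 0, ‖x'‖ ≤ 2/3}` lie in the unit ball and are fixed by `r`
  have hSball : ∀ x : 𝔼 (n + 1), (split n x).2 = 0 → ‖(split n x).1‖ ≤ 2 / 3 → ‖x‖ ≤ 1 := by
    intro x hx2 hx1
    have h := norm_sq_eq_split n x
    rw [hx2, norm_zero] at h
    nlinarith [norm_nonneg x, norm_nonneg (split n x).1]
  have hSfix : ∀ x : 𝔼 (n + 1), (split n x).2 = 0 → lastReflection n x = x := by
    intro x hx2
    apply (split n).injective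
    refine Prod.ext (split_lastReflection_fst x) ?_
    rw [split_lastReflection_snd, hx2, neg_zero]
  have hsq0 : ∀ x : 𝔼 (n + 1), (split n x).2 = 0 → (squeeze n 12 ε x).2 = 0 := by
    intro x hx2; rw [squeeze_apply]; simp [hx2, ballContraction_zero]
  -- `S` is carried by the discs onto `φ(2𝔻)` and `φ'(2𝔻)`
  have hS : ∀ (g : 𝔼 n → 𝕊 (n + 1)) (core : 𝔼 n × 𝔼 1 → 𝕊 (n + 1)),
      (∀ y : 𝔼 n, core (y, 0) = g y) →
      (core ∘ squeeze n 12 ε) '' {x | (split n x).2 = 0 ∧ ‖(split n x).1‖ ≤ 2 / 3} =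
        g '' closedBall 0 2 := by
    intro g core hcore
    apply Subset.antisymm
    · rintro _ ⟨x, ⟨hx2, hx1⟩, rfl⟩
      have hx : ‖x‖ ≤ 1 := hSball x hx2 hx1
      refine ⟨(3 : ℝ) • (split n x).1, ?_, ?_⟩
      · rw [mem_closedBall_zero_iff, norm_smul, Real.norm_ofNat]; linarith
      · symm
        show core (squeeze n 12 ε x) = _
        rw [show squeeze n 12 ε x = ((squeeze n 12 ε x).1, (squeeze n 12 ε x).2) from rfl, hsq3 x hx,
          hsq0 x hx2, hcore]
    · rintro _ ⟨y, hy, rfl⟩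
      rw [mem_closedBall_zero_iff] at hy
      set x : 𝔼 (n + 1) := (split n).symm ((3 : ℝ)⁻¹ • y, 0) with hxdef
      have hx1 : (split n x).1 = (3 : ℝ)⁻¹ • y := by rw [hxdef, (split n).apply_symm_apply]
      have hx2 : (split n x).2 = 0 := by rw [hxdef, (split n).apply_symm_apply]
      have hn1 : ‖(split n x).1‖ ≤ 2 / 3 := by
        rw [hx1, norm_smul, norm_inv, Real.norm_ofNat]; linarith
      have hx : ‖x‖ ≤ 1 := hSball x hx2 hn1
      refine ⟨x, ⟨hx2, hn1⟩, ?_⟩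
      show core (squeeze n 12 ε x) = g y
      rw [show squeeze n 12 ε x = ((squeeze n 12 ε x).1, (squeeze n 12 ε x).2) from rfl, hsq3 x hx, hx1,
        hsq0 x hx2, smul_smul, mul_inv_cancel₀ (by norm_num : (3 : ℝ) ≠ 0), one_smul, hcore]
  have hSi : i '' {x | (split n x).2 = 0 ∧ ‖(split n x).1‖ ≤ 2 / 3} = φ '' closedBall 0 2 :=
    hS φ hfr.core hfr.core_zero
  have hSi' : i' '' {x | (split n x).2 = 0 ∧ ‖(split n x).1‖ ≤ 2 / 3} = stdDisc n '' closedBall 0 2 :=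
    hS (stdDisc n) hfr'.core hfr'.core_zero
  -- ### the open set `W = i(O)` contains `S_L`
  set O : Set (𝔼 (n + 1)) := {x | ‖x‖ < 1 ∧ 1 / 3 < ‖(split n x).1‖} with hOdef
  have hOopen : IsOpen O :=
    (isOpen_lt continuous_norm continuous_const).inter
      (isOpen_lt continuous_const (continuous_norm.comp (continuous_fst.comp (split n).continuous)))
  have hWopen : IsOpen (i '' O) := hiopen O hOopen
  have hWSL : {v : 𝕊 (n + 1) | zc n (v : 𝔼 (n + 1 + 1)) = 0} ⊆ i '' O := by
    intro v hv
    have hv : zc n (v : 𝔼 (n + 1 + 1)) = 0 := hv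
    have hv0 : (v : 𝔼 (n + 1 + 1)) 0 = 0 := by simpa using congrArg Complex.re hv
    have hv1 : (v : 𝔼 (n + 1 + 1)) 1 = 0 := by simpa using congrArg Complex.im hv
    obtain ⟨y, hy, hyv⟩ : v ∈ stdDisc n '' closedBall 0 2 := by
      rw [image_stdDisc_closedBall]; exact ⟨hv1, hv0.ge⟩
    rw [mem_closedBall_zero_iff] at hy
    have hy2 : ‖y‖ = 2 := by
      have h := coe_stdDisc_apply_zero n y
      rw [hyv, hv0] at h
      have h' : 4 - ‖y‖ ^ 2 = 0 := by
        have hpos : (0 : ℝ) < 4 + ‖y‖ ^ 2 := by positivity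
        field_simp at h
        linarith
      nlinarith [norm_nonneg y]
    set x : 𝔼 (n + 1) := (split n).symm ((3 : ℝ)⁻¹ • y, 0) with hxdef
    have hx1 : (split n x).1 = (3 : ℝ)⁻¹ • y := by rw [hxdef, (split n).apply_symm_apply]
    have hx2 : (split n x).2 = 0 := by rw [hxdef, (split n).apply_symm_apply]
    have hn1 : ‖(split n x).1‖ = 2 / 3 := by
      rw [hx1, norm_smul, norm_inv, Real.norm_ofNat, hy2]; norm_num
    have hxn : ‖x‖ = 2 / 3 := by
      have h := norm_sq_eq_split n x
      rw [hx2, norm_zero, hn1] at h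
      nlinarith [norm_nonneg x]
    refine ⟨x, ⟨by rw [hxn]; norm_num, by rw [hn1]; norm_num⟩, ?_⟩
    show hfr.core (squeeze n 12 ε x) = v
    rw [show squeeze n 12 ε x = ((squeeze n 12 ε x).1, (squeeze n 12 ε x).2) from rfl,
      hsq3 x (by rw [hxn]; norm_num), hx1, hsq0 x hx2, smul_smul,
      mul_inv_cancel₀ (by norm_num : (3 : ℝ) ≠ 0), one_smul, hfr.core_zero, hφstd y (by rw [hy2]; norm_num),
      hyv]
  have hOr : ∀ x ∈ O, lastReflection n x ∈ O := fun x hx ↦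
    ⟨by rw [LinearIsometryEquiv.norm_map]; exact hx.1, by rw [split_lastReflection_fst]; exact hx.2⟩
  have hrr : ∀ x : 𝔼 (n + 1), lastReflection n (lastReflection n x) = x := fun x ↦
    Submodule.reflection_reflection _ _
  -- ### the disc theorem, two cases
  obtain ⟨F, -, hF⟩ := exists_diffeomorph_apply_disc_eq_or_reflect_cs (M := 𝕊 (n + 1))
    (Nat.succ_ne_zero n) hi hi' (lastReflection n).toContinuousLinearEquiv det_lastReflection_neg
  rcases hF with hF | hF
  · -- Case 1: `F ∘ i = i'` on `𝔻`: `F = id` on `W`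
    refine ⟨F, i '' O, hWopen, hWSL, ?_, ?_⟩
    · rintro _ ⟨x, hx, rfl⟩
      rw [hF x hx.1.le, ← hagree x hx.1.le hx.2]
    · rw [← hSi, ← hSi', image_image]
      apply Subset.antisymm
      · rintro _ ⟨x, hx, rfl⟩; exact ⟨x, hx, (hF x (hSball x hx.1 hx.2)).symm⟩
      · rintro _ ⟨x, hx, rfl⟩; exact ⟨x, hx, hF x (hSball x hx.1 hx.2)⟩
  · -- Case 2: `F ∘ i ∘ r = i'` on `𝔻`: `F = R` on `W`, and `F' = R ∘ F` works
    have hF' : ∀ x : 𝔼 (n + 1), ‖x‖ ≤ 1 → F (i (lastReflection n x)) = i' x := fun x hx ↦ hF x hx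
    refine ⟨F.trans (eqReflection n), i '' O, hWopen, hWSL, ?_, ?_⟩
    · rintro _ ⟨x, hx, rfl⟩
      rw [Diffeomorph.coe_trans, comp_apply]
      have h1 := hF' (lastReflection n x) (by rw [LinearIsometryEquiv.norm_map]; exact hx.1.le)
      rw [hrr, hequiv] at h1
      rw [h1, ← hagree x hx.1.le hx.2]
      exact eqReflection_eqReflection _
    · rw [Diffeomorph.coe_trans, image_comp]
      have hFS : F '' (φ '' closedBall 0 2) = stdDisc n '' closedBall 0 2 := by
        rw [← hSi, ← hSi', image_image]
        apply Subset.antisymm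
        · rintro _ ⟨x, hx, rfl⟩
          refine ⟨x, hx, ?_⟩
          have h1 := hF' x (hSball x hx.1 hx.2)
          rw [hSfix x hx.1] at h1
          exact h1.symm
        · rintro _ ⟨x, hx, rfl⟩
          refine ⟨x, hx, ?_⟩
          have h1 := hF' x (hSball x hx.1 hx.2)
          rw [hSfix x hx.1] at h1
          exact h1
      rw [hFS, image_stdDisc_closedBall]
      apply Subset.antisymm
      · rintro _ ⟨v, hv, rfl⟩
        rw [eqReflection_of_apply_one hv.1]; exact hv
      · intro v hv
        exact ⟨v, hv, eqReflection_of_apply_one hv.1⟩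

end CerfPalais

end Surgery

end BudneyGabai2019_thm_3_13

end Literature.Topology.FourManifolds

end
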